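import Summits.HodgeConjecture.CorCM.DecicWeil23PairDihedralHodgeOfMarkman
import HarnessLib

/-!
# COR-CM — two DISJOINT `(2,3)`-types over a decic CM field with dihedral (non-cyclic) quintic part, OFF THE MIRROR POSITION:
# the Hodge conjecture for every product of copies of `E, B₁, B₂`, GIVEN ONLY Markman's hyperbolic-sixfold theorem

Cell `pub-hodgecm2` (COR-CM), seat b30 gen 23 (2026-08-22); count-neutral own lane DECIC-2T, part 3 («DECIC-D5», disjoint case).
Theorems only; no definition, no named fact, no `sorry`.  HONEST FRAMING: CONDITIONAL on the single displayed named fact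
`HodgeTheory.Markman2025_weilClasses_algebraic_hyperbolicSixfold` (E. Markman, arXiv:2502.03415 Thm 1.5.1 — UNREFEREED); `HC_CM`
is not asserted and no case of the Hodge conjecture is claimed unconditionally.

WHAT IS NEW.  `CorCM/DecicWeil23PairDihedralHodgeOfMarkman` treats two `(2,3)`-types SHARING one embedding over `τ`; here the
types are DISJOINT over `τ`.  By the census (`Census/DecicWeil23PairDihedral`: `dihGood false j ⟺ j ∉ {1, 2}`) two of the six
dihedral positions are genuinely bad: those whose dihedral group contains the involution `(0 1)(2 3)` preserving both type
supports (the «mirror» position, nullity `6`).  Intrinsically, for an enumeration `x` of the fibre rotated by `ρ` and reflected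
by `ρ'` (`hD5`), the five reflections of the realised dihedral group are `x_l ↦ x_{m−l}`; the NON-MIRROR hypothesis `hnm` asks
that none of them preserve both `Φ₁ ∩ x` and `Φ₂ ∩ x`.  Under it the position is clean and the whole chain applies.
* `decide` facts on the involution `(0 1)(2 3) = swap 0 1 * swap 2 3` (`dihGood false j` fails iff `D₅(j)` contains it; a word of
  `g D₅(0) g⁻¹` equal to it is a conjugate reflection, acting on the enumeration as `l ↦ m − l`; it preserves the supports
  `{0,1}`, `{3,2}`), `normalPos_eq_false_of_disjoint`;
* **`hodgeConjectureFor_biproduct_comp_vec_of_markmanD_dihedral_disjoint`** and its `AVDominatedBy` form.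
[cite: Markman2025SecantWeil, Thm 1.5.1] [cite: Pohlmann1968, Thm 1] [cite: Shimura1998, §18.2 Lemma (i)] [cite: DixonMortimer1996, §2.1]
[cite: MumfordAV1970, §19]

## References
* [Markman2025SecantWeil] E. Markman, arXiv:2502.03415 (unrefereed), Thm 1.5.1.  [Pohlmann1968] H. Pohlmann, Ann. of Math. 88
  (1968), Thm 1.  [Shimura1998] G. Shimura, *Abelian varieties with CM and modular functions*, §18.2 Lemma (i).
  [DixonMortimer1996] J. D. Dixon, B. Mortimer, *Permutation Groups*, GTM 163 (1996), §2.1.  [MumfordAV1970] D. Mumford,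
  *Abelian Varieties*, §19.
-/

noncomputable section

open CategoryTheory CategoryTheory.Limits NumberField

namespace Summit.HodgeConjecture.CorCM.DecicWeil23Pair

open Literature.AlgebraicGeometry Literature.AlgebraicGeometry.Motives Literature.AlgebraicGeometry.HodgeTheory
open Literature.AlgebraicGeometry.ComplexMultiplication (IsCMTypeRealisation)
open Literature.AlgebraicTopology.SingularHomology
open Summit.HodgeConjecture.CorCM.Census.DecicWeil23Pair (inPos dihPerm dihTab dihedralPerms mem_dihedralPerms dihGood
  dihPerm_eq_word)
open Summit.HodgeConjecture.CorCM.OcticCurveFourfold (exists_delta_of_mem)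
open Summit.HodgeConjecture.CorCM.Domination (AVDominatedBy)

open scoped Classical

/-! ## §1 The mirror involution `(0 1)(2 3)`, by `decide` -/

/-- **The bad dihedral positions for disjoint types are those containing the involution `(0 1)(2 3)`.** [folklore] -/
theorem dihGood_false_iff : ∀ j : Fin 6, dihGood false j = true ↔
    ∀ t : Fin 10, dihPerm j t ≠ Equiv.swap (0 : Fin 5) 1 * Equiv.swap (2 : Fin 5) 3 := by
  decide +kernel

/-- **A word of `g D₅(0) g⁻¹` equal to `(0 1)(2 3)` is a conjugate reflection, acting on the labels as `l ↦ m − l`.** [folklore] -/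
theorem exists_conj_reflection_eq_swap : ∀ (g : Equiv.Perm (Fin 5)) (n : Fin 5) (u : Fin 2),
    (g * dihPerm 0 1 * g⁻¹) ^ (n : ℕ) * (g * dihPerm 0 5 * g⁻¹) ^ (u : ℕ) = Equiv.swap (0 : Fin 5) 1 * Equiv.swap (2 : Fin 5) 3 →
      ∃ m : Fin 5, ∀ l : Fin 5, g (m - l) = (Equiv.swap (0 : Fin 5) 1 * Equiv.swap (2 : Fin 5) 3) (g l) := by
  decide +kernel

/-- `(0 1)(2 3)` preserves both disjoint type supports `{0,1}` and `{3,2}`. [folklore] -/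
theorem inPos_false_swap : ∀ (m : Fin 2) (y : Fin 5),
    inPos false m ((Equiv.swap (0 : Fin 5) 1 * Equiv.swap (2 : Fin 5) 3) y) = inPos false m y := by
  decide

/-! ## §2 The intrinsic theorem: disjoint types, non-mirror position -/

section Main

variable {K : Type} [Field K] [NumberField K] [IsCMField K] {k : Type} [Field k] [NumberField k] [IsCMField k] {N : ℕ}
  {Φ₁ Φ₂ : CMType K} {B₁ B₂ : AbelianVariety ℂ}
  {ι₁ : 𝓞 K →+* End B₁} {θ₁ : K →+* Module.End ℂ (complexBetti B₁.X 1)}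
  {ι₂ : 𝓞 K →+* End B₂} {θ₂ : K →+* Module.End ℂ (complexBetti B₂.X 1)}
  {Ψ : CMType k} {E : AbelianVariety ℂ} {ιE : 𝓞 k →+* End E} {θE : k →+* Module.End ℂ (complexBetti E.X 1)}

omit [IsCMField K] [NumberField k] [IsCMField k] in
/-- **Disjoint types sit at the disjoint normal position**: if `Φ₁`, `Φ₂` are read at `inPos c 0`, `inPos c 1` in a frame and
share no embedding over `τ`, then `c = false`. [folklore] -/
theorem normalPos_eq_false_of_disjoint {e : (K →+* ℂ) ≃ Fin 5 × Bool} {i : k →+* K} {τ : k →+* ℂ} {c : Bool}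
    (he_sign : ∀ s, (e s).2 = true ↔ s.comp i = τ)
    (hr₁ : ∀ s, s ∈ Φ₁.1 ↔ (e s).2 = inPos c 0 (e s).1) (hr₂ : ∀ s, s ∈ Φ₂.1 ↔ (e s).2 = inPos c 1 (e s).1)
    (hdisj : (Finset.univ.filter fun s : K →+* ℂ => s.comp i = τ ∧ (s ∈ Φ₁.1 ∧ s ∈ Φ₂.1)).card = 0) : c = false := by
  have hP : ∀ a : Fin 5, (e.symm (a, true) ∈ Φ₁.1 ∧ e.symm (a, true) ∈ Φ₂.1) ↔
      (inPos c 0 a = true ∧ inPos c 1 a = true) := fun a => by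
    rw [hr₁, hr₂, Equiv.apply_symm_apply]
    exact ⟨fun h => ⟨h.1.symm, h.2.symm⟩, fun h => ⟨h.1.symm, h.2.symm⟩⟩
  have h0 : (Finset.univ.filter fun a : Fin 5 => inPos c 0 a = true ∧ inPos c 1 a = true).card = 0 := by
    have key := card_filter_symm_true₅ he_sign (fun s => s ∈ Φ₁.1 ∧ s ∈ Φ₂.1)
    have key' : (Finset.univ.filter fun a : Fin 5 => e.symm (a, true) ∈ Φ₁.1 ∧ e.symm (a, true) ∈ Φ₂.1).card = 0 := by
      convert hdisj using 1
      convert key using 3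
    calc (Finset.univ.filter fun a : Fin 5 => inPos c 0 a = true ∧ inPos c 1 a = true).card
        = (Finset.univ.filter fun a : Fin 5 => e.symm (a, true) ∈ Φ₁.1 ∧ e.symm (a, true) ∈ Φ₂.1).card := by
          congr 1
          exact Finset.filter_congr fun a _ => (hP a).symm
      _ = 0 := key'
  cases c
  · rfl
  · exact absurd h0 (by decide)

/-- **THE HODGE CONJECTURE FOR EVERY PRODUCT OF COPIES OF `E, B₁, B₂` — two `(2,3)`-fivefolds over a decic `K ⊇ i(k)` whose
types are DISJOINT over `τ`, non-cyclic quintic part, OFF THE MIRROR POSITION — GIVEN ONLY Markman's hyperbolic-sixfold theorem.**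
Hypotheses: `B_l ⊨ (K; Φ_l)` with two members over `τ` each (`h23ₗ`) and none in common (`hdisj`); `E ⊨ (k; Ψ ∋ τ)`; an
enumeration `x` of the five embeddings over `τ` ROTATED by one automorphism of `ℂ` and REFLECTED by another (`hD5`); and the
NON-MIRROR condition `hnm`: no reflection `x_l ↦ x_{m−l}` preserves both `Φ₁ ∩ x` and `Φ₂ ∩ x` (for the dihedral quintic part
`D₅` this excludes exactly the configurations carrying exceptional classes; for `F₂₀`, `A₅`, `S₅` use the `2`-transitive theorem
instead).  Conclusion: for every `κ : Fin N → Fin 3`, every rational `(q,q)`-class on `⨁_j ![E, B₁, B₂](κ j)` is algebraic.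
[cite: Markman2025SecantWeil, Thm 1.5.1] [cite: Pohlmann1968, Thm 1] [cite: Shimura1998, §18.2 Lemma (i)] [cite: MumfordAV1970, §19] -/
theorem hodgeConjectureFor_biproduct_comp_vec_of_markmanD_dihedral_disjoint
    (hM6 : Markman2025_weilClasses_algebraic_hyperbolicSixfold)
    (h10 : Module.finrank ℚ K = 10) (h2 : Module.finrank ℚ k = 2) (i : k →+* K)
    (hB₁ : IsCMTypeRealisation Φ₁ B₁ ι₁ θ₁) (hB₂ : IsCMTypeRealisation Φ₂ B₂ ι₂ θ₂) (hE : IsCMTypeRealisation Ψ E ιE θE)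
    {τ : k →+* ℂ} (hτΨ : τ ∈ Ψ.1)
    (h23₁ : (Finset.univ.filter fun s : K →+* ℂ => s.comp i = τ ∧ s ∈ Φ₁.1).card = 2)
    (h23₂ : (Finset.univ.filter fun s : K →+* ℂ => s.comp i = τ ∧ s ∈ Φ₂.1).card = 2)
    (hdisj : (Finset.univ.filter fun s : K →+* ℂ => s.comp i = τ ∧ (s ∈ Φ₁.1 ∧ s ∈ Φ₂.1)).card = 0)
    {x : Fin 5 ↪ {s : K →+* ℂ // s.comp i = τ}}
    (hD5 : ∃ ρ ρ' : ℂ ≃+* ℂ,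
      (∀ l : Fin 5, (ρ : ℂ →+* ℂ).comp (x l).1 = (x (l + 1)).1) ∧ (∀ l : Fin 5, (ρ' : ℂ →+* ℂ).comp (x l).1 = (x (-l)).1))
    (hnm : ∀ m : Fin 5, ¬ ((∀ l : Fin 5, (x l).1 ∈ Φ₁.1 ↔ (x (m - l)).1 ∈ Φ₁.1) ∧
      (∀ l : Fin 5, (x l).1 ∈ Φ₂.1 ↔ (x (m - l)).1 ∈ Φ₂.1)))
    (κ : Fin N → Fin 3) :
    HodgeConjectureFor (⨁ fun j => (![E, B₁, B₂] : Fin 3 → AbelianVariety ℂ) (κ j)).dim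
      (⨁ fun j => (![E, B₁, B₂] : Fin 3 → AbelianVariety ℂ) (κ j)).X := by
  have hττ : ComplexEmbedding.conjugate τ ≠ τ := QuarticCM.conjugate_ne τ
  have hk : ∀ σ : k →+* ℂ, σ = τ ∨ σ = ComplexEmbedding.conjugate τ := fun σ =>
    QuarticCM.eq_or_eq_conjugate_of_quadratic h2 τ σ
  have hΨ : ∀ σ : k →+* ℂ, σ ∈ Ψ.1 ↔ σ = τ := by
    intro σ
    rcases hk σ with rfl | rfl
    · exact ⟨fun _ => rfl, fun _ => hτΨ⟩
    · exact ⟨fun h => absurd h ((Ψ.2 τ).1 hτΨ), fun h => absurd h hττ⟩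
  -- the types are different (they share no embedding over `τ`, each has two)
  have hne : Φ₁ ≠ Φ₂ := by
    rintro rfl
    have h : (Finset.univ.filter fun s : K →+* ℂ => s.comp i = τ ∧ (s ∈ Φ₁.1 ∧ s ∈ Φ₁.1)) =
        Finset.univ.filter fun s : K →+* ℂ => s.comp i = τ ∧ s ∈ Φ₁.1 :=
      Finset.filter_congr fun s _ => by rw [and_self_iff]
    rw [h, h23₁] at hdisj
    exact absurd hdisj (by norm_num)
  obtain ⟨δ₀, d, hd, hδ₀⟩ := CyclicSextic.exists_sq_eq_neg_nat_of_isTotallyComplex k h2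
  obtain ⟨δ, hδ, hτ⟩ := exists_delta_of_mem h2 hd hδ₀ τ
  -- the frame in normal form; disjoint types force `c = false`
  obtain ⟨e, c, he_sign, he_conj, hr₁, hr₂⟩ := exists_frameD h10 h2 i hττ hk Φ₁ Φ₂ h23₁ h23₂ hne
  have hc : c = false := normalPos_eq_false_of_disjoint he_sign hr₁ hr₂ hdisj
  subst hc
  -- the realised rotation and reflection, read in the frame (same labelling `g`)
  obtain ⟨ρ, ρ', hρ, hρ'⟩ := hD5
  obtain ⟨g, hg, hrot⟩ := conj_mem_realisedPerms_of_enum he_sign x (f := dihPerm 0 1) (ρ := ρ)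
    fun l => by rw [dihPerm_zero_one_apply]; exact hρ l
  obtain ⟨g', hg', hrefl⟩ := conj_mem_realisedPerms_of_enum he_sign x (f := dihPerm 0 5) (ρ := ρ')
    fun l => by rw [dihPerm_zero_five_apply]; exact hρ' l
  have hgg : g' = g := by
    ext l
    have h := (hg' l).trans (hg l).symm
    exact congrArg Fin.val (Prod.mk.inj (e.symm.injective h)).1
  rw [hgg] at hrefl
  obtain ⟨j, ⟨⟨a, ha⟩, ⟨b, hb⟩⟩, hsub⟩ := exists_dihedralPerms_subset_realisedPerms hrot hrefl
  -- reading the types on the enumeration: `x_l ∈ Φ₁ ⟺ inPos false 0 (g l)`, `x_l ∈ Φ₂ ⟺ inPos false 1 (g l)`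
  have h1l : ∀ l : Fin 5, (e (x l).1).1 = g l := fun l => by
    have h := congrArg e (hg l)
    rw [Equiv.apply_symm_apply] at h
    exact (congrArg Prod.fst h).symm
  have h2l : ∀ l : Fin 5, (e (x l).1).2 = true := fun l => (he_sign _).2 (x l).2
  have hread₁ : ∀ l : Fin 5, (x l).1 ∈ Φ₁.1 ↔ inPos false 0 (g l) = true := fun l => by
    rw [hr₁, h2l, h1l]; exact ⟨fun h => h.symm, fun h => h.symm⟩
  have hread₂ : ∀ l : Fin 5, (x l).1 ∈ Φ₂.1 ↔ inPos false 1 (g l) = true := fun l => by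
    rw [hr₂, h2l, h1l]; exact ⟨fun h => h.symm, fun h => h.symm⟩
  -- the position is clean: otherwise `(0 1)(2 3) ∈ D₅(j) = g D₅(0) g⁻¹` is a reflection `x_l ↦ x_{m−l}` preserving both supports
  have hgood : dihGood false j = true := by
    rw [dihGood_false_iff]
    intro t ht
    obtain ⟨n, u, hw⟩ := dihPerm_eq_word j a b t
    rw [← ha, ← hb, ht] at hw
    obtain ⟨m, hm⟩ := exists_conj_reflection_eq_swap g n u hw.symm
    refine hnm m ⟨fun l => ?_, fun l => ?_⟩
    · rw [hread₁ l, hread₁ (m - l), hm l, inPos_false_swap]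
    · rw [hread₂ l, hread₂ (m - l), hm l, inPos_false_swap]
  -- the family `Kf = (k, K)` and the three slots `(k, K, K)`
  let Kf : Fin 2 → Type := Fin.cons k fun _ : Fin 1 => K
  letI instF : ∀ j, Field (Kf j) := fun j =>
    Fin.cases (motive := fun j => Field (Kf j)) ‹Field k› (fun _ => ‹Field K›) j
  letI instN : ∀ j, NumberField (Kf j) := fun j =>
    Fin.cases (motive := fun j => NumberField (Kf j)) ‹NumberField k› (fun _ => ‹NumberField K›) j
  haveI instC : ∀ j, IsCMField (Kf j) := fun j =>
    Fin.cases (motive := fun j => IsCMField (Kf j)) ‹IsCMField k› (fun _ => ‹IsCMField K›) j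
  exact hodgeConjectureFor_biproduct_comp_of_frameD_of_markmanSixfold_dihedral (Kf := Kf) (i₀ := 0) (i₁ := 1) (c := false)
    (A₃ := ![E, B₁, B₂])
    (Φ₃ := Fin.cons Ψ (Fin.cons Φ₁ (Fin.cons Φ₂ finZeroElim)))
    (ι₃ := Fin.cons ιE (Fin.cons ι₁ (Fin.cons ι₂ finZeroElim)))
    (θ₃ := Fin.cons θE (Fin.cons θ₁ (Fin.cons θ₂ finZeroElim))) hM6 κ h10 h2 i hd hδ hτ
    (Fin.cases hE (Fin.cases hB₁ (Fin.cases hB₂ fun l => l.elim0))) e he_sign he_conj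
    (Fin.cases hr₁ (Fin.cases hr₂ fun l => l.elim0)) hΨ (j := j) hgood hsub

/-- **… and for every abelian variety dominated by such a product.** [cite: Markman2025SecantWeil, Thm 1.5.1] [cite: MumfordAV1970, §19] -/
theorem hodgeConjectureFor_of_avDominatedBy_comp_vec_of_markmanD_dihedral_disjoint
    (hM6 : Markman2025_weilClasses_algebraic_hyperbolicSixfold)
    (h10 : Module.finrank ℚ K = 10) (h2 : Module.finrank ℚ k = 2) (i : k →+* K)
    (hB₁ : IsCMTypeRealisation Φ₁ B₁ ι₁ θ₁) (hB₂ : IsCMTypeRealisation Φ₂ B₂ ι₂ θ₂) (hE : IsCMTypeRealisation Ψ E ιE θE)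
    {τ : k →+* ℂ} (hτΨ : τ ∈ Ψ.1)
    (h23₁ : (Finset.univ.filter fun s : K →+* ℂ => s.comp i = τ ∧ s ∈ Φ₁.1).card = 2)
    (h23₂ : (Finset.univ.filter fun s : K →+* ℂ => s.comp i = τ ∧ s ∈ Φ₂.1).card = 2)
    (hdisj : (Finset.univ.filter fun s : K →+* ℂ => s.comp i = τ ∧ (s ∈ Φ₁.1 ∧ s ∈ Φ₂.1)).card = 0)
    {x : Fin 5 ↪ {s : K →+* ℂ // s.comp i = τ}}
    (hD5 : ∃ ρ ρ' : ℂ ≃+* ℂ,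
      (∀ l : Fin 5, (ρ : ℂ →+* ℂ).comp (x l).1 = (x (l + 1)).1) ∧ (∀ l : Fin 5, (ρ' : ℂ →+* ℂ).comp (x l).1 = (x (-l)).1))
    (hnm : ∀ m : Fin 5, ¬ ((∀ l : Fin 5, (x l).1 ∈ Φ₁.1 ↔ (x (m - l)).1 ∈ Φ₁.1) ∧
      (∀ l : Fin 5, (x l).1 ∈ Φ₂.1 ↔ (x (m - l)).1 ∈ Φ₂.1)))
    (κ : Fin N → Fin 3) {C : AbelianVariety ℂ}
    (hC : AVDominatedBy C (⨁ fun j => (![E, B₁, B₂] : Fin 3 → AbelianVariety ℂ) (κ j))) :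
    HodgeConjectureFor C.dim C.X :=
  Domination.hodgeConjectureFor_of_avDominatedBy
    (hodgeConjectureFor_biproduct_comp_vec_of_markmanD_dihedral_disjoint hM6 h10 h2 i hB₁ hB₂ hE hτΨ h23₁ h23₂ hdisj hD5 hnm κ)
    hC

end Main

end Summit.HodgeConjecture.CorCM.DecicWeil23Pair

end
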